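import Summits.CriticalPhenomena.Ising3DConformalLimit.Theorems.EnergyNotSigmaSquaredMoebiusLimitExistsOrbitLiouvilleDefs
import Summits.CriticalPhenomena.Ising3DConformalLimit.Theorems.EnergyNotSigmaSquaredMoebiusLimitExistsOneMapOneJetDefs
import HarnessLib

/-!
# Algebra of the elliptic Möbius flow about the unit circle

Stub `stub_flowAlgebra` (S2) of the line `Sketch` (§1, card `complex-circle-rotation-liouville`) for the
crux `MoebiusLimitExists` (item stmt-CriticalPhenomena-1344). The elliptic flow
`h_ψ = ellipticFlow ψ` of `ℝ³` ("rotation by the angle `ψ` about the unit circle `{y₂ = 0, ‖y‖ = 1}`",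
the stereographic pull-back of a rotation of `S³`), `h_ψ(y) = N(y, ψ) / D(y, ψ)` with `D = flowDen` and
`N = flowNum` from the objects file `…OrbitLiouvilleDefs`, satisfies the four finite identities the line
evaluates along an orbit:

* (i) `D(y, ·)` and `h_·(y)` are `2π`-periodic;
* (ii) `h_0 = id` (`D(y, 0) = 2`, `N(y, 0) = 2y`);
* (iii) the half-turn is the unit inversion after the sign flip of the third coordinate,
  `h_π = ι ∘ R₃` (`D(y, π) = 2‖y‖²`, `N(y, π) = 2 R₃ y`, `‖R₃ y‖ = ‖y‖`);
* (iv) `D(y, ψ) > 0` at every real angle for `y` off the `x₂`-axis, by Cauchy–Schwarz: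
  `(2y₂ sin ψ + (‖y‖² − 1) cos ψ)² ≤ 4y₂² + (‖y‖² − 1)² = (‖y‖² + 1)² − 4(y₀² + y₁²) < (‖y‖² + 1)²`.

Reference: the elliptic one-parameter subgroups of the Möbius group of `ℝ³ ∪ {∞}` ("rotations about a
circle"), Benedetti–Petronio, Lectures on Hyperbolic Geometry (1992), ch. A; here everything is a
finite coordinate computation with `sin ψ`, `cos ψ` and the coordinates of `y`.
-/

noncomputable section

open EuclideanGeometry

namespace Summit.CriticalPhenomena.Ising3DConformalLimit.MoebiusLimitExistsOrbitLiouville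

/-! ### (i) Periodicity -/

/-- The denominator `D(y, ·)` is `2π`-periodic. [folklore] -/
theorem flowDen_add_two_pi (y : EuclideanSpace ℝ (Fin 3)) (ψ : ℝ) :
    flowDen y (ψ + 2 * Real.pi) = flowDen y ψ := by
  simp only [flowDen, Real.sin_add_two_pi, Real.cos_add_two_pi]

/-- The numerator `N(y, ·)` is `2π`-periodic. [folklore] -/
theorem flowNum_add_two_pi (y : EuclideanSpace ℝ (Fin 3)) (ψ : ℝ) :
    flowNum y (ψ + 2 * Real.pi) = flowNum y ψ := by
  simp only [flowNum, Real.sin_add_two_pi, Real.cos_add_two_pi]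

/-- The flow `ψ ↦ h_ψ(y)` is `2π`-periodic. [folklore] -/
theorem ellipticFlow_add_two_pi (y : EuclideanSpace ℝ (Fin 3)) (ψ : ℝ) :
    ellipticFlow (ψ + 2 * Real.pi) y = ellipticFlow ψ y := by
  simp only [ellipticFlow, flowDen_add_two_pi, flowNum_add_two_pi]

/-! ### (ii) The flow at angle `0` -/

/-- `h_0 = id`: at angle `0` the denominator is `2` and the numerator is `2y`. [folklore] -/
theorem ellipticFlow_zero_apply (y : EuclideanSpace ℝ (Fin 3)) : ellipticFlow 0 y = y := by
  ext j
  simp only [ellipticFlow, flowDen_at_zero, flowNum, Real.sin_zero, Real.cos_zero, PiLp.smul_apply,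
    smul_eq_mul]
  fin_cases j <;> simp

/-! ### (iii) The half-turn -/

/-- `h_π = ι ∘ R₃`: at angle `π` the denominator is `2‖y‖²` and the numerator is
`(2y₀, 2y₁, −2y₂) = 2 R₃ y`, while `‖R₃ y‖ = ‖y‖`; no hypothesis `y ≠ 0` is needed (both sides are the
junk value `0` at the origin; `ι p = p / ‖p‖²` is
`MoebiusLimitExistsOneMapOneJet.inversion_zero_one_eq_smul`). [folklore] -/
theorem ellipticFlow_pi_apply (y : EuclideanSpace ℝ (Fin 3)) :
    ellipticFlow Real.pi y = inversion 0 1 (flipThree y) := by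
  rw [MoebiusLimitExistsOneMapOneJet.inversion_zero_one_eq_smul, LinearIsometryEquiv.norm_map]
  ext j
  simp only [ellipticFlow, flowDen_at_pi, flowNum, Real.sin_pi, Real.cos_pi, PiLp.smul_apply,
    smul_eq_mul, flipThree_apply]
  fin_cases j <;> simp <;> ring

/-! ### (iv) Positivity of the denominator off the `x₂`-axis -/

/-- Lagrange's identity for the angular part of `D`:
`(b sin ψ + c cos ψ)² + (b cos ψ − c sin ψ)² = b² + c²`. [folklore] -/
theorem flowAlgebra_lagrange (b c ψ : ℝ) :
    (b * Real.sin ψ + c * Real.cos ψ) ^ 2 + (b * Real.cos ψ - c * Real.sin ψ) ^ 2 = b ^ 2 + c ^ 2 := by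
  linear_combination (b ^ 2 + c ^ 2) * Real.sin_sq_add_cos_sq ψ

/-- `D(y, ψ) > 0` for every real angle `ψ` as soon as `y` is off the `x₂`-axis: with `s = ‖y‖²`,
`(2y₂ sin ψ + (s − 1) cos ψ)² ≤ 4y₂² + (s − 1)² = (s + 1)² − 4(y₀² + y₁²) < (s + 1)²`, so
`2y₂ sin ψ + (s − 1) cos ψ < s + 1`. [folklore] -/
theorem flowDen_pos_of_off_axis (y : EuclideanSpace ℝ (Fin 3)) (ψ : ℝ) (hy : y 0 ≠ 0 ∨ y 1 ≠ 0) :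
    0 < flowDen y ψ := by
  have hq : 0 < y 0 ^ 2 + y 1 ^ 2 := by
    rcases hy with h | h
    · have h0 : 0 < y 0 ^ 2 := sq_pos_iff.2 h
      nlinarith [sq_nonneg (y 1)]
    · have h1 : 0 < y 1 ^ 2 := sq_pos_iff.2 h
      nlinarith [sq_nonneg (y 0)]
  have hs : ‖y‖ ^ 2 = y 0 ^ 2 + y 1 ^ 2 + y 2 ^ 2 := by
    rw [EuclideanSpace.real_norm_sq_eq, Fin.sum_univ_three]
  have key := flowAlgebra_lagrange (2 * y 2) (‖y‖ ^ 2 - 1) ψ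
  have hlt : (2 * y 2 * Real.sin ψ + (‖y‖ ^ 2 - 1) * Real.cos ψ) ^ 2 < (‖y‖ ^ 2 + 1) ^ 2 := by
    nlinarith [sq_nonneg (2 * y 2 * Real.cos ψ - (‖y‖ ^ 2 - 1) * Real.sin ψ), sq_nonneg (y 2)]
  have hle : (0 : ℝ) ≤ ‖y‖ ^ 2 + 1 := by positivity
  have h4 := (abs_lt.1 (abs_lt_of_sq_lt_sq hlt hle)).2
  unfold flowDen
  linarith

/-! ### The registered stub -/

/-- **Flow algebra** (stub `stub_flowAlgebra`, S2, of the line `Sketch`): (i) `2π`-periodicity of `D` and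
`h` in the angle, (ii) `h_0 = id`, (iii) `h_π = ι ∘ R₃` (unit inversion after the sign flip of the
third coordinate), (iv) `D(y, ψ) > 0` off the `x₂`-axis. [folklore] -/
theorem stub_flowAlgebra :
    (∀ (y : EuclideanSpace ℝ (Fin 3)) (ψ : ℝ), flowDen y (ψ + 2 * Real.pi) = flowDen y ψ ∧
        ellipticFlow (ψ + 2 * Real.pi) y = ellipticFlow ψ y) ∧
    (∀ y : EuclideanSpace ℝ (Fin 3), ellipticFlow 0 y = y) ∧
    (∀ y : EuclideanSpace ℝ (Fin 3), y ≠ 0 →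
        ellipticFlow Real.pi y = EuclideanGeometry.inversion 0 1 (flipThree y)) ∧
    (∀ (y : EuclideanSpace ℝ (Fin 3)) (ψ : ℝ), (y 0 ≠ 0 ∨ y 1 ≠ 0) → 0 < flowDen y ψ) :=
  ⟨fun y ψ => ⟨flowDen_add_two_pi y ψ, ellipticFlow_add_two_pi y ψ⟩, ellipticFlow_zero_apply,
    fun y _ => ellipticFlow_pi_apply y, flowDen_pos_of_off_axis⟩

end Summit.CriticalPhenomena.Ising3DConformalLimit.MoebiusLimitExistsOrbitLiouville

end
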